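import Summits.BirchSwinnertonDyer.Rank1Residual.Additive.CyclotomicZpExtensionQuadratic
import Literature.NumberTheory.GaloisRepresentations.RestrictFieldSemisimple
import Literature.NumberTheory.GaloisRepresentations.ArtinFormalismInductionProofs
import Mathlib.NumberTheory.Cyclotomic.PrimitiveRoots
import HarnessLib

/-!
# The cyclotomic `ℤ_p`-extension `ℚ(μ_{p^∞})/ℚ(μ_p)` with a normalised topological generator
# (hypothesis `hexF` of line V19 of the cell `b2b-bsdres`, discharged)

HONEST FRAMING (cell `b2b-bsdres`, run/shared/lean/b2b/bsd-rank1-residual/, verbatim in every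
file): the goal of the cell is to DELETE the COMBINATION-SHAPED residual classes of the
Birch–Swinnerton-Dyer formula for ALL analytic-rank `≤ 1` elliptic curves over `ℚ` — "full BSD
formula for every rank `≤ 1` curve in class `C`" assembled STRICTLY from published theorems — so
that the rank-`≤ 1` remainder becomes exactly the CONSTRUCTION-SHAPED classes, which are TYPED
(missing-input `Prop`s), NOT attempted. This is not "finishing BSD". Seat additive-p4 (research route
on the construction-shaped additive classes X3/X4); no label moves; nothing is booked here.

Theorems only (no `def`, no `sorry`, no named fact). Line V19 reads Kato's Thm. 17.4 (3) /
Wuthrich's Thm. 16 — statements about `X(E/ℚ(μ_{p^∞}))` over the Iwasawa algebra of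
`Gal(ℚ(μ_{p^∞})/ℚ) ≅ ℤ_p^×` — over the NUMBER FIELD `F = ℚ(μ_p)`, of which `ℚ(μ_{p^∞})` is
literally the cyclotomic `ℤ_p`-extension (`p` odd). This file constructs that `ℤ_p`-extension in
the tree's vocabulary (`ZpExtension F p`, `IsCyclotomic`, `IsTopGenerator`), generalising the
quadratic case `exists_zpExtension_isCyclotomic_of_finrank_eq_two` (seat additive-p4, gen 5): for ANY
finite Galois extension `L/ℚ` of degree prime to `p` (`p` odd) the restriction of the `p`-adic
cyclotomic character to `Γ_L` still covers `1 + pℤ_p = γ_cyc^{ℤ_p}` — every `g^{[L:ℚ]}`, `g ∈ Γ_ℚ`,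
is a restriction from `Γ_L` (the image of `Γ_L` is normal of index `[L : ℚ]`, tree
`normal_range_absGaloisRestrict`, `index_range_absGaloisRestrict_eq_finrank`) and `[L : ℚ]` is a
unit of `ℤ_p` — so `κ_L := ℓ ∘ χ_p|_{Γ_L}` (`ℓ = CyclotomicZp.ell p`, `ℓ(γ_cyc^x) = x`,
`ker ℓ = μ(ℤ_p)`) is a surjective, CYCLOTOMIC `ℤ_p`-extension with a generator `γ ∈ Γ_L`,
`χ_p(γ) = γ_cyc = 1 + p` exactly. Specialisation: `L = F = ℚ(ζ_p)` (`IsCyclotomicExtension {p} ℚ F`,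
`[F : ℚ] = p − 1`), giving the literal hypothesis `hexF` of the line-V19 core theorem with `ζ = 1`.

References: L. C. Washington, *Introduction to Cyclotomic Fields*, §13.1 (the cyclotomic
`ℤ_p`-extension of a number field); J. Neukirch, *Algebraic Number Theory*, Ch. IV §1.
-/

noncomputable section

open Field

namespace Summit.BirchSwinnertonDyer.Rank1Residual.Additive

open Literature.NumberTheory.EllipticCurves Literature.NumberTheory.EllipticCurves.CyclotomicZp
  Literature.NumberTheory.GaloisRepresentations

section CoprimeDegree

variable (L : Type) [Field L] [NumberField L] (p : ℕ) [Fact p.Prime]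

/-- `γ_cyc^a` raised to the `n`-th power is `γ_cyc^{n·a}` (as units of `ℤ_p`). [folklore] -/
theorem cycPowUnit_pow (a : ℤ_[p]) (n : ℕ) :
    cycPowUnit p a ^ n = cycPowUnit p ((n : ℤ_[p]) * a) := by
  induction n with
  | zero =>
    ext
    rw [pow_zero, Nat.cast_zero, zero_mul, val_cycPowUnit, Units.val_one, AddChar.map_zero_eq_one]
  | succ n ih =>
    rw [pow_succ, ih, cycPowUnit_mul_cycPowUnit, Nat.cast_succ, add_mul, one_mul]

/-- **The `[L : ℚ]`-th power of any `g ∈ Γ_ℚ` is a restriction from `Γ_L`** when `L/ℚ` is a finite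
Galois extension: the image of `Γ_L → Γ_ℚ` is a normal subgroup of index `[L : ℚ]` (tree
`normal_range_absGaloisRestrict`, `index_range_absGaloisRestrict_eq_finrank`), and `g^{[G:H]} ∈ H`
for a normal subgroup `H` of finite index. [folklore] -/
theorem pow_finrank_mem_range_absGaloisRestrict [IsGalois ℚ L] (g : absoluteGaloisGroup ℚ) :
    g ^ Module.finrank ℚ L ∈ Set.range (absGaloisRestrict ℚ L) := by
  haveI : ((absGaloisRestrict ℚ L).range).Normal := normal_range_absGaloisRestrict ℚ L
  have h := (absGaloisRestrict ℚ L).range.pow_index_mem g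
  rw [index_range_absGaloisRestrict_eq_finrank ℚ L] at h
  exact h

/-- **`χ_p(Γ_L) ⊇ γ_cyc^{ℤ_p} = 1 + pℤ_p`** for a finite Galois `L/ℚ` of degree prime to the odd
prime `p`: every `γ_cyc^x` is a value of the `p`-adic cyclotomic character on `Γ_L`
(`x = [L:ℚ] · w` in `ℤ_p`, `χ_p(g) = γ_cyc^w` for some `g ∈ Γ_ℚ` by surjectivity over `ℚ`, and
`g^{[L:ℚ]} = res σ`). [folklore] -/
theorem exists_cyclotomicCharacter_eq_cycPowUnit_of_coprime [IsGalois ℚ L]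
    (hcop : (Module.finrank ℚ L).Coprime p) (x : ℤ_[p]) :
    ∃ σ : absoluteGaloisGroup L, GaloisRep.cyclotomicCharacter L p σ = cycPowUnit p x := by
  set n : ℕ := Module.finrank ℚ L with hn
  -- `n ∈ ℤ_pˣ`
  have hnu : IsUnit ((n : ℤ) : ℤ_[p]) := by
    rw [PadicInt.isUnit_iff]
    refine le_antisymm (PadicInt.norm_le_one _) (not_lt.mp fun hlt ↦ ?_)
    rw [PadicInt.norm_int_lt_one_iff_dvd] at hlt
    have hdvd : p ∣ n := by exact_mod_cast hlt
    exact (Fact.out : p.Prime).one_lt.ne' ((Nat.coprime_comm.mp hcop).eq_one_of_dvd hdvd)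
  obtain ⟨w, hw⟩ : ∃ w : ℤ_[p], (n : ℤ_[p]) * w = x := by
    refine ⟨(hnu.unit⁻¹ : ℤ_[p]ˣ) * x, ?_⟩
    have hn' : ((n : ℤ) : ℤ_[p]) = (n : ℤ_[p]) := by norm_cast
    rw [← mul_assoc, ← hn', IsUnit.mul_val_inv, one_mul]
  obtain ⟨g, hg⟩ := GaloisRep.cyclotomicCharacter_rat_surjective p (cycPowUnit p w)
  obtain ⟨σ, hσ⟩ := pow_finrank_mem_range_absGaloisRestrict L g
  refine ⟨σ, ?_⟩
  haveI : NeZero (p : ℚ) := ⟨by exact_mod_cast (Fact.out : p.Prime).ne_zero⟩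
  rw [← cyclotomicCharacter_absGaloisRestrict ℚ L p σ, hσ, map_pow, hg, cycPowUnit_pow, ← hn, hw]

/-- **The cyclotomic `ℤ_p`-extension of a finite Galois extension `L/ℚ` of degree prime to `p`,
constructed** (`p` odd): there is a `ℤ_p`-extension `κ` of `L` which is CYCLOTOMIC
(`ker κ = χ_p⁻¹(μ(ℤ_p))`, i.e. `L_∞ = L·ℚ_∞ ⊆ L(μ_{p^∞})`), given by `κ(σ) = ℓ(χ_p(σ))` with the
tree's normalised logarithm `ℓ = CyclotomicZp.ell p` (`ℓ(γ_cyc^x) = x`, `ker ℓ = μ(ℤ_p)`),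
together with a NORMALISED topological generator `γ ∈ Γ_L`: `κ(γ) = 1` and
`χ_p(γ) = γ_cyc = 1 + p^{e₀}` (`e₀ = 1` for odd `p`). (Washington §13.1; the prime-to-`p`-degree twin of the tree's quadratic
`exists_zpExtension_isCyclotomic_of_finrank_eq_two`.) [cite: Washington1997, §13.1] -/
theorem exists_zpExtension_isCyclotomic_of_coprime [IsGalois ℚ L]
    (hcop : (Module.finrank ℚ L).Coprime p) :
    ∃ κ : ZpExtension L p, κ.IsCyclotomic ∧
      (∀ σ, κ σ = Multiplicative.ofAdd (ell p (GaloisRep.cyclotomicCharacter L p σ))) ∧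
      ∃ γ : absoluteGaloisGroup L, κ.IsTopGenerator γ ∧
        ((GaloisRep.cyclotomicCharacter L p γ : ℤ_[p]ˣ) : ℤ_[p]) = (cyclotomicGenerator p : ℤ_[p]) := by
  let κ : ZpExtension L p :=
    { toContinuousMonoidHom := (ellHom p).comp (GaloisRep.cyclotomicCharacter L p)
      surjective := by
        intro y
        obtain ⟨σ, hσ⟩ := exists_cyclotomicCharacter_eq_cycPowUnit_of_coprime L p hcop y.toAdd
        refine ⟨σ, ?_⟩
        change ellHom p (GaloisRep.cyclotomicCharacter L p σ) = y
        rw [hσ, ellHom_apply, ell_cycPowUnit, ofAdd_toAdd] }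
  have hκ : ∀ σ, κ σ = Multiplicative.ofAdd (ell p (GaloisRep.cyclotomicCharacter L p σ)) :=
    fun _ ↦ rfl
  refine ⟨κ, ?_, hκ, ?_⟩
  · ext σ
    rw [ZpExtension.mem_kerSubgroup, Subgroup.mem_comap, CommGroup.mem_torsion, hκ, ofAdd_eq_one,
      ell_eq_zero_iff]
    rfl
  · obtain ⟨γ, hγ⟩ := exists_cyclotomicCharacter_eq_cycPowUnit_of_coprime L p hcop 1
    refine ⟨γ, ?_, ?_⟩
    · rw [ZpExtension.IsTopGenerator, hκ, hγ, ell_cycPowUnit]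
    · rw [hγ, val_cycPowUnit, cycPow_one]

end CoprimeDegree

/-! ### `F = ℚ(ζ_p)`: the hypothesis `hexF` of line V19, discharged -/

section CyclotomicPrime

variable (p : ℕ) [Fact p.Prime] (K : Type) [Field K] [NumberField K] [IsCyclotomicExtension {p} ℚ K]

/-- `[ℚ(ζ_p) : ℚ] = p − 1`. [folklore] -/
theorem finrank_eq_sub_one_of_isCyclotomicExtension_prime :
    Module.finrank ℚ K = p - 1 := by
  haveI : NeZero p := ⟨(Fact.out : p.Prime).ne_zero⟩
  rw [IsCyclotomicExtension.finrank K (Polynomial.cyclotomic.irreducible_rat (NeZero.pos p)),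
    Nat.totient_prime (Fact.out : p.Prime)]

/-- `[ℚ(ζ_p) : ℚ] = p − 1` is prime to `p`. [folklore] -/
theorem finrank_coprime_of_isCyclotomicExtension_prime :
    (Module.finrank ℚ K).Coprime p := by
  rw [finrank_eq_sub_one_of_isCyclotomicExtension_prime p K]
  have hp := (Fact.out : p.Prime)
  exact ((Nat.Prime.coprime_iff_not_dvd hp).mpr
    (Nat.not_dvd_of_pos_of_lt (Nat.sub_pos_of_lt hp.one_lt) (Nat.sub_lt hp.pos Nat.one_pos))).symm

/-- **`hexF` holds**: `F = ℚ(ζ_p)` (`p` prime) has a cyclotomic `ℤ_p`-extension `κ`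
(`F_∞ = ℚ(μ_{p^∞})`) with a topological generator `γ ∈ Γ_F`, `κ(γ) = 1`, and
`χ_p(γ)·ζ = γ_cyc = 1 + p^{e₀}` (`= 1 + p` for odd `p`) for a root of unity `ζ ∈ ℤ_pˣ` (here `ζ = 1`) — literally the inline
hypothesis `hexF` of the line-V19 core theorem, in the shape of the `K = ℚ(ζ₃)` twin
`exists_isCyclotomic_isTopGenerator_cyclotomicThree`. [cite: Washington1997, §13.1] -/
theorem exists_isCyclotomic_isTopGenerator_cyclotomicPrime :
    ∃ κ : ZpExtension K p, κ.IsCyclotomic ∧ ∃ γ : absoluteGaloisGroup K,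
      κ.IsTopGenerator γ ∧ ∃ ζ : ℤ_[p]ˣ, IsOfFinOrder ζ ∧
        ((GaloisRep.cyclotomicCharacter K p γ * ζ : ℤ_[p]ˣ) : ℤ_[p]) =
          (cyclotomicGenerator p : ℤ_[p]) := by
  haveI : NeZero p := ⟨(Fact.out : p.Prime).ne_zero⟩
  haveI : IsGalois ℚ K := IsCyclotomicExtension.isGalois {p} ℚ K
  obtain ⟨κ, hκ, -, γ, hγ, hχ⟩ := exists_zpExtension_isCyclotomic_of_coprime K p
    (finrank_coprime_of_isCyclotomicExtension_prime p K)
  exact ⟨κ, hκ, γ, hγ, 1, IsOfFinOrder.one, by rw [mul_one, hχ]⟩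

end CyclotomicPrime

end Summit.BirchSwinnertonDyer.Rank1Residual.Additive

end
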